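import Summits.ResolutionOfSingularities.ResolutionOfSingularities.Theorems.RadicialJungCleanModelsGiraudLogJacobianLocalization
import Mathlib.RingTheory.Ideal.Height
import Mathlib.RingTheory.Localization.AtPrime.Basic
import HarnessLib

/-!
# Route `RadicialJung`, crux `CleanModels` (stmt-15917): the CRITICAL PRIMES of a stalk from the chart —
# brick B3 / FILE 6 (first half of step (S1) of `L/res-L1-s42-pv-2/w81-B3/B3-PLAN.md`) of T2-ARCHITECTURE

Support file (OURS) for PROGRAMME-clean-dim2 / T2 (`HOME/L/res-L0-w81-pv-2/g5/T2-ARCHITECTURE.md`, brick **B3**);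
seat res-L1-s42-pv-2 g7 (res-plan-2 IDLE POOL DEAL #50 (2)); line `via-clean-models` of the crux `DescentPerfectToAll`
(stmt-0549).  Nothing here is a statement of Hironaka's manuscript.  AI-written; AI review weaker than expert review.

FILE 5 (`…GiraudSingularFiniteOfCharts`, p563225) proves B3 from ADAPTED CHARTS; its one geometric binder is `hcrit`: at
every point `ξ` of the chart the critical primes of the stalk (the height-one primes of `𝒪_{X,ξ}` containing `J(𝒪_ξ, f)`,
derivation form) are exactly the `(x_j)𝒪_ξ` with `x_j(ξ) = 0`.  This file reduces `hcrit` to a GLOBAL statement on the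
chart ring `A`: if the height-one primes of `A` containing `J(A, f)` are exactly the `(x_j)` — «`E(f) ∩ U = V(x₁) ∪ … ∪
V(x_r)` with the `V(x_j)` integral» — then `hcrit` holds at every localization `A_𝔮` (hence at every stalk,
`IsAffineOpen.isLocalization_stalk`).  Ingredients: FILE 4 `derivJacobianIdeal_eq_map_of_isLocalization`
(`J(A_𝔮, f) = J(A, f)·A_𝔮`, projective `Ω[A⁄ℤ]`) and Mathlib's prime correspondence for localizations with heights
(`IsLocalization.isPrime_iff_isPrime_disjoint`, `map_under`, `height_under`, `height_map_of_disjoint`,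
`AtPrime.isUnit_to_map_iff`).

* `derivCriticalPrimes_iff_of_isLocalization_atPrime` — the reduction;
* `under_mem_of_mem_derivCriticalPrimes` / `map_mem_derivCriticalPrimes` — the two directions separately.
-/

noncomputable section

set_option linter.dupNamespace false -- mandated namespace of this single-conjunct summit

open Literature.AlgebraicGeometry.Resolution

namespace Summit.ResolutionOfSingularities.ResolutionOfSingularities.Theorems.RadicialJung.CleanModels

universe u v

variable {A : Type u} [CommRing A] (𝔮 : Ideal A) [𝔮.IsPrime] (S : Type v) [CommRing S] [Algebra A S]
  [IsLocalization.AtPrime S 𝔮]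

/-- **Down**: a critical prime `P` of the localization `S = A_𝔮` at `f` contracts to a height-one prime `𝔭 ⊆ 𝔮` of `A`
containing `J(A, f)`, and `P = 𝔭·S` (projective `Ω[A⁄ℤ]`: `J(S, f) = J(A, f)·S`). -/
theorem under_mem_of_mem_derivCriticalPrimes [Module.Projective A Ω[A⁄ℤ]] (f : A) {P : Ideal S}
    (hP : P ∈ derivCriticalPrimes S (algebraMap A S f)) :
    (P.under A).IsPrime ∧ (P.under A).height = 1 ∧ derivJacobianIdeal A f ≤ P.under A ∧ P.under A ≤ 𝔮 ∧
      (P.under A).map (algebraMap A S) = P := by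
  obtain ⟨hPprime, hPht, hPJ⟩ := hP
  haveI := hPprime
  have h1 := (IsLocalization.isPrime_iff_isPrime_disjoint 𝔮.primeCompl S P).mp hPprime
  refine ⟨h1.1, ?_, ?_, ?_, IsLocalization.map_under 𝔮.primeCompl S P⟩
  · rw [IsLocalization.height_under 𝔮.primeCompl]
    exact hPht
  · rw [derivJacobianIdeal_eq_map_of_isLocalization S 𝔮.primeCompl f] at hPJ
    intro a ha
    exact Ideal.mem_comap.mpr (hPJ (Ideal.mem_map_of_mem _ ha))
  · intro a ha
    by_contra hnot
    exact Set.disjoint_left.mp h1.2 hnot ha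

/-- **Up**: a height-one prime `𝔭 ⊆ 𝔮` of `A` containing `J(A, f)` extends to a critical prime `𝔭·S` of `S = A_𝔮`. -/
theorem map_mem_derivCriticalPrimes [Module.Projective A Ω[A⁄ℤ]] (f : A) {𝔭 : Ideal A} [𝔭.IsPrime]
    (hht : 𝔭.height = 1) (hJ : derivJacobianIdeal A f ≤ 𝔭) (h𝔮 : 𝔭 ≤ 𝔮) :
    𝔭.map (algebraMap A S) ∈ derivCriticalPrimes S (algebraMap A S f) := by
  have hdisj : Disjoint (𝔮.primeCompl : Set A) (𝔭 : Set A) :=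
    Set.disjoint_left.mpr fun a ha ha' => ha (h𝔮 ha')
  refine ⟨IsLocalization.isPrime_of_isPrime_disjoint 𝔮.primeCompl S 𝔭 ‹_› hdisj, ?_, ?_⟩
  · rw [IsLocalization.height_map_of_disjoint 𝔮.primeCompl 𝔭 hdisj]
    exact hht
  · rw [derivJacobianIdeal_eq_map_of_isLocalization S 𝔮.primeCompl f]
    exact Ideal.map_mono hJ

include 𝔮 in
/-- **The critical primes of a stalk from the chart.**  If the height-one primes of `A` containing `J(A, f)` are
exactly the `(x_j)` (each prime of height one containing `J(A, f)`), then at the localization `S = A_𝔮` the critical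
primes at `f` are exactly the `(x_j)S` with `x_j` a non-unit of `S` (i.e. `x_j ∈ 𝔮`) — the binder `hcrit` of FILE 5. -/
theorem derivCriticalPrimes_iff_of_isLocalization_atPrime [Module.Projective A Ω[A⁄ℤ]] (f : A) {r : ℕ}
    (x : Fin r → A)
    (hx : ∀ j, (Ideal.span {x j}).IsPrime ∧ (Ideal.span {x j}).height = 1 ∧ derivJacobianIdeal A f ≤ Ideal.span {x j})
    (honly : ∀ 𝔭 : Ideal A, 𝔭.IsPrime → 𝔭.height = 1 → derivJacobianIdeal A f ≤ 𝔭 → ∃ j, 𝔭 = Ideal.span {x j}) :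
    ∀ P : Ideal S, P ∈ derivCriticalPrimes S (algebraMap A S f) ↔
      ∃ j, ¬ IsUnit (algebraMap A S (x j)) ∧ P = Ideal.span {algebraMap A S (x j)} := by
  intro P
  constructor
  · intro hP
    obtain ⟨hpr, hht, hJ, hle, hmap⟩ := under_mem_of_mem_derivCriticalPrimes 𝔮 S f hP
    obtain ⟨j, hj⟩ := honly _ hpr hht hJ
    refine ⟨j, ?_, ?_⟩
    · rw [IsLocalization.AtPrime.isUnit_to_map_iff S 𝔮]
      intro hnot
      exact hnot (hle (hj ▸ Ideal.mem_span_singleton_self (x j)))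
    · rw [← hmap, hj, Ideal.map_span, Set.image_singleton]
  · rintro ⟨j, hunit, rfl⟩
    obtain ⟨hpr, hht, hJ⟩ := hx j
    haveI := hpr
    have hx𝔮 : x j ∈ 𝔮 := by
      rw [IsLocalization.AtPrime.isUnit_to_map_iff S 𝔮] at hunit
      by_contra h
      exact hunit h
    have hle : Ideal.span {x j} ≤ 𝔮 := (Ideal.span_singleton_le_iff_mem _).mpr hx𝔮
    have h := map_mem_derivCriticalPrimes 𝔮 S f hht hJ hle
    rwa [Ideal.map_span, Set.image_singleton] at h

end Summit.ResolutionOfSingularities.ResolutionOfSingularities.Theorems.RadicialJung.CleanModels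

end
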